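import Summits.QuantumFields.YangMills.Theorems.BalabanUVNodesN08AlphaProfileThreshold

/-!
# Route «BalabanUVNodes», Track-A DAG node N08 = [Balaban1985UV3] — (α) clause: the CHOSEN external inputs `XeOf` and the record-predicate closer
# whose displayed clause is «DATA SCHEMA on `XeOf`» and NOTHING of the in-edge side

Cell `pub-ymgap`, seat `pub-ymgap-dag-n08-d` gen 5, file F9 (over F8 `…ProfileThreshold`).  `bears_on: R4∕N08`; filed `--supports stmt-QuantumFields-19910
--as helper`.  Sorry-free, standard axioms.

* §1 `XeOf 𝔊 𝔠 X₀ hstd w hX hX0 hC Bk : ∀ S, ExternalInputs S G` — THE external inputs of F8's `exists_externalInputs_b10_main_family_of_threshold`, chosen once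
  (`Exists.choose`), with their spec: standard averaging and `X₀`'s classes everywhere; on the family `g²ε₀ ≤ (min γ_N08^d 1)²` measurable `U_k(·,h)`,
  `InEdgeFaces₃ 𝔊 (regMin 𝔠) (XeOf … S)`, `RunAlpha` from the DATA schema; and N08 by name at the C-binding over their constructed runs from the DATA schema.
* §2 ★★ `b10_main_at_record_of_dataPin` — gen 3's `ThreeFaces.b10_main_at_record_of_faces₃Pin` (chair R434 (c1) idiom «ESTIMATE ASSUMED AS ADMISSIBILITY»)
  with the THREE IN-EDGE FACES GONE from the displayed clause: for any predicate `Rec` on binding worlds under which, at every run, SOME record `𝔠` with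
  `4π ≤ min C68 (2L²B₃)`, some direction `X ∈ 𝔤 ∖ 0`, some standard-averaging inputs `X₀`, expansion data `𝔖`, auxiliary data `𝔄` and sizes `coef` — whose
  cluster-expansion DATA SCHEMA holds for the chosen inputs `XeOf …` on the family — bind the upstream as the C-binding over carriers whose B10 runs ARE the
  constructed family of `XeOf …`, N08 holds at every `Rec`-world and run.
HONEST FRAMING: the DATA schema (`RunDataRows` = the cluster expansion of [B10]∕[8]–[10], census classes II + III) stays DISPLAYED — the object gap of N08;
count-neutral; NOT a discharge of N08.  d = 3 on finite tori as printed; nothing about d = 4, the continuum, OS axioms, a mass gap or Clay.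
-/

noncomputable section

namespace Summit.QuantumFields.YangMills.Theorems.BalabanUVNodesN08AlphaProfileRecord

open MeasureTheory Set
open scoped Matrix
open Literature.MathematicalPhysics.QuantumFieldTheory.Balaban1983to89
open Literature.MathematicalPhysics.QuantumFieldTheory.Balaban1983to89.B10SectCExpansion (TermSizes)
open Literature.MathematicalPhysics.QuantumFieldTheory.Balaban1985CMP102
open Literature.MathematicalPhysics.QuantumFieldTheory.Balaban1985CMP102.Setting
open Literature.MathematicalPhysics.QuantumFieldTheory.Balaban1983to89.DagBinding (leavesP WorldP PrintedCarriersR PrintedCarriers9X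
  PrintedCarriers11 PrintedCarriers14R PrintedCarriers15)
open Literature.MathematicalPhysics.QuantumFieldTheory.Balaban1983to89.B10CompactBinding (ofPrintedAllXPNC)
open Summit.QuantumFields.Balaban3D.Carriers
open Summit.QuantumFields.Balaban3D.Proofs.Inputs
open Summit.QuantumFields.Balaban3D.Proofs.Primitives (AlphaConsts)
open Summit.QuantumFields.Balaban3D.Proofs.GroupModelLieC (lieC)
open Summit.QuantumFields.Balaban3D.Proofs.UVStability3DInputs
open Summit.QuantumFields.Balaban3D.Proofs.FamilyLE (ScalesLE)
open Summit.QuantumFields.YangMills.Theorems.BalabanUVNodesN08AlphaClassI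
open Summit.QuantumFields.YangMills.Theorems.BalabanUVNodesN08AlphaLoop28
open Summit.QuantumFields.YangMills.Theorems.BalabanUVNodesN08AlphaThreeFaces (regMin)
open Summit.QuantumFields.YangMills.Theorems.BalabanUVNodesN08AlphaProfileThreshold

variable {L : ℕ} {G : Type} [GaugeGroup G] [MeasurableSpace G] [HaarData G] (𝔊 : GroupModel G) (𝔠 : AlphaConsts L 𝔊.N)

/-! ## §1 The chosen external inputs `XeOf` and their spec -/

/-- **THE CHOSEN EXTERNAL INPUTS** of the in-edge END (F8 `exists_externalInputs_b10_main_family_of_threshold`, `Exists.choose`): minimiser selections in the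
constraint spaces of the constructed regular h-large profiles, standard averaging, `X₀`'s regular classes; parameters: the base inputs `X₀` (standard
averaging `hstd`), a real parameter `w`, a direction `X ∈ 𝔤 ∖ 0`, the size condition `4π ≤ min C68 (2L²B₃)`, bond sets `Bk`.
[cite: Balaban1985UV3, (41)–(42) p.266 + (67)–(68) p.273; Balaban1985Variational, Thm 1 p.279] -/
def XeOf (X₀ : ∀ S : Scales L, ExternalInputs S G) (hstd : ∀ S : Scales L, (X₀ S).av = AveragingRT.stdAvg S.P G) (w : ℝ)
    {X : Matrix (Fin 𝔊.N) (Fin 𝔊.N) ℂ} (hX : X ∈ 𝔊.lie) (hX0 : X ≠ 0) (hC : 4 * Real.pi ≤ (regMin 𝔠).C68)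
    (Bk : ∀ (S : Scales L) (k : ℕ), Hist S.P k → Set (PBond S.P k)) : ∀ S : Scales L, ExternalInputs S G :=
  (exists_externalInputs_b10_main_family_of_threshold 𝔊 𝔠 X₀ hstd w hX hX0 hC Bk).choose

section Spec

variable (X₀ : ∀ S : Scales L, ExternalInputs S G) (hstd : ∀ S : Scales L, (X₀ S).av = AveragingRT.stdAvg S.P G) (w : ℝ)
  {X : Matrix (Fin 𝔊.N) (Fin 𝔊.N) ℂ} (hX : X ∈ 𝔊.lie) (hX0 : X ≠ 0) (hC : 4 * Real.pi ≤ (regMin 𝔠).C68)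
  (Bk : ∀ (S : Scales L) (k : ℕ), Hist S.P k → Set (PBond S.P k))

/-- `XeOf` has standard averaging and `X₀`'s regular classes, for every `S`. [cite: Balaban1985UV3, (41) p.266] -/
theorem XeOf_av_reg (S : Scales L) :
    (XeOf 𝔊 𝔠 X₀ hstd w hX hX0 hC Bk S).av = AveragingRT.stdAvg S.P G ∧ (XeOf 𝔊 𝔠 X₀ hstd w hX hX0 hC Bk S).reg = (X₀ S).reg :=
  (exists_externalInputs_b10_main_family_of_threshold 𝔊 𝔠 X₀ hstd w hX hX0 hC Bk).choose_spec.1 S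

/-- ON THE FAMILY `g²ε₀ ≤ (min γ_N08^d 1)²`: `XeOf`'s `U_k(·,h)` are measurable, the THREE IN-EDGE FACES `InEdgeFaces₃ 𝔊 (regMin 𝔠) (XeOf … S)` HOLD, and the
DATA schema gives `RunAlpha`. [cite: Balaban1985UV3, Thm 2 p.272 + (41)–(42) p.266 + (44) p.267 + (67)–(68) p.273; Balaban1985Variational, Thm 1 p.279; Balaban1985Averaging, Prop. 2 (54) p.26] -/
theorem XeOf_spec_of_le {S : Scales L} (hle : S.g ^ 2 * S.ε₀ ≤ (min (gammaN08d 𝔠) 1) ^ 2) :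
    (∀ (k : ℕ) (h : Hist S.P k), Measurable ((XeOf 𝔊 𝔠 X₀ hstd w hX hX0 hC Bk S).UkH k h)) ∧
      InEdgeFaces₃ 𝔊 (regMin 𝔠) (XeOf 𝔊 𝔠 X₀ hstd w hX hX0 hC Bk S) ∧
      ∀ (𝔖 : ∀ k, StepSeries S G ↥(lieC 𝔊) (nblkOf S 𝔠.lane.carrier k) k) (𝔄 : AlphaData 𝔊 𝔠 (XeOf 𝔊 𝔠 X₀ hstd w hX hX0 hC Bk S) 𝔖)
        (coef : (k : ℕ) → Hist S.P (k + 1) → GaugeField S.P (k + 1) G → (j : ℕ) → TermSizes (oldGeom S.P k j)),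
        RunDataRows 𝔊 𝔠 (XeOf 𝔊 𝔠 X₀ hstd w hX hX0 hC Bk S) 𝔖 𝔄 (sizesOf 𝔊 𝔠 (XeOf 𝔊 𝔠 X₀ hstd w hX hX0 hC Bk S) coef) →
          RunAlpha 𝔊 𝔠 (XeOf 𝔊 𝔠 X₀ hstd w hX hX0 hC Bk S) 𝔖 𝔄 :=
  (exists_externalInputs_b10_main_family_of_threshold 𝔊 𝔠 X₀ hstd w hX hX0 hC Bk).choose_spec.2.1 S hle

/-- **N08 BY NAME AT THE C-BINDING OVER THE CONSTRUCTED RUNS OF `XeOf`, FROM THE DATA SCHEMA ALONE** (on the family `g²ε₀ ≤ (min γ_N08^d 1)²`).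
[cite: Balaban1985UV3, Thm 1 p.257 (compact reading) + Thm 2 p.272] -/
theorem b10_main_upC_XeOf
    (𝔖 : ∀ (S : Scales L) (k : ℕ), StepSeries S G ↥(lieC 𝔊) (nblkOf S 𝔠.lane.carrier k) k)
    (𝔄 : ∀ S : Scales L, AlphaData 𝔊 𝔠 (XeOf 𝔊 𝔠 X₀ hstd w hX hX0 hC Bk S) (𝔖 S))
    (coef : ∀ (S : Scales L) (k : ℕ), Hist S.P (k + 1) → GaugeField S.P (k + 1) G → (j : ℕ) → TermSizes (oldGeom S.P k j))
    (Xc : PrintedCarriersR) (Y : PrintedCarriers9X) (Z : PrintedCarriers11) (V : PrintedCarriers14R) (W : PrintedCarriers15)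
    (w' : WorldP) (P : B12.RunParams)
    (hD : ∀ S : Scales L, S.g ^ 2 * S.ε₀ ≤ (min (gammaN08d 𝔠) 1) ^ 2 →
      RunDataRows 𝔊 𝔠 (XeOf 𝔊 𝔠 X₀ hstd w hX hX0 hC Bk S) (𝔖 S) (𝔄 S) (sizesOf 𝔊 𝔠 (XeOf 𝔊 𝔠 X₀ hstd w hX hX0 hC Bk S) (coef S)))
    (hup : w'.up P = ofPrintedAllXPNC (Xc.withTowerRuns10 fun S : ScalesLE L ((min (gammaN08d 𝔠) 1) ^ 2) =>
      towerOf 𝔠.lane (XeOf 𝔊 𝔠 X₀ hstd w hX hX0 hC Bk S.1) (𝔖 S.1)) Y Z V W) :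
    Dag.B10_main (leavesP w' P) :=
  (exists_externalInputs_b10_main_family_of_threshold 𝔊 𝔠 X₀ hstd w hX hX0 hC Bk).choose_spec.2.2 𝔖 𝔄 coef Xc Y Z V W w' P hD hup

end Spec

/-! ## §2 The record-predicate closer: displayed clause «DATA SCHEMA on `XeOf`», no in-edge face -/

/-- **★★ RECORD-PREDICATE FORM WITH THE DISPLAYED CLAUSE «DATA SCHEMA» AND NOTHING OF THE IN-EDGE SIDE** (the shape of `S_N08 Rec := AtRecord Rec
Dag.B10_main` at a C-bound `Rec`, chair R434 (c1) idiom «ESTIMATE ASSUMED AS ADMISSIBILITY»; gen 3's `ThreeFaces.b10_main_at_record_of_faces₃Pin` with its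
three in-edge faces DISCHARGED by the construction of this seat): for any predicate `Rec` on binding worlds under which, at every run, SOME constants record
`𝔠` with `4π ≤ min C68 (2L²B₃)`, some direction `X ∈ 𝔤 ∖ 0`, some standard-averaging base inputs `X₀`, a parameter `w`, bond sets `Bk`, expansion data `𝔖`,
auxiliary data `𝔄` and sizes `coef` — whose cluster-expansion DATA SCHEMA (at the concrete loop sizes) holds for the chosen inputs `XeOf …` on the family
`g²ε₀ ≤ (min γ_N08^d 1)²` — bind the upstream as the C-binding over carriers whose B10 runs ARE the constructed family of `XeOf …`, N08 holds at every
`Rec`-world and run. [cite: Balaban1985UV3, Thm 1 p.257 (compact reading) + Thm 2 p.272 (bookkeeping shape)] -/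
theorem b10_main_at_record_of_dataPin (Rec : WorldP → Prop)
    (hpin : ∀ w', Rec w' → ∀ P : B12.RunParams,
      ∃ (𝔠 : AlphaConsts L 𝔊.N) (hC : 4 * Real.pi ≤ (regMin 𝔠).C68) (X : Matrix (Fin 𝔊.N) (Fin 𝔊.N) ℂ) (hX : X ∈ 𝔊.lie) (hX0 : X ≠ 0)
        (X₀ : ∀ S : Scales L, ExternalInputs S G) (hstd : ∀ S : Scales L, (X₀ S).av = AveragingRT.stdAvg S.P G) (w : ℝ)
        (Bk : ∀ (S : Scales L) (k : ℕ), Hist S.P k → Set (PBond S.P k))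
        (𝔖 : ∀ (S : Scales L) (k : ℕ), StepSeries S G ↥(lieC 𝔊) (nblkOf S 𝔠.lane.carrier k) k)
        (𝔄 : ∀ S : Scales L, AlphaData 𝔊 𝔠 (XeOf 𝔊 𝔠 X₀ hstd w hX hX0 hC Bk S) (𝔖 S))
        (coef : ∀ (S : Scales L) (k : ℕ), Hist S.P (k + 1) → GaugeField S.P (k + 1) G → (j : ℕ) → TermSizes (oldGeom S.P k j))
        (Xc : PrintedCarriersR) (Y : PrintedCarriers9X) (Z : PrintedCarriers11) (V : PrintedCarriers14R) (W : PrintedCarriers15),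
        (∀ S : Scales L, S.g ^ 2 * S.ε₀ ≤ (min (gammaN08d 𝔠) 1) ^ 2 →
            RunDataRows 𝔊 𝔠 (XeOf 𝔊 𝔠 X₀ hstd w hX hX0 hC Bk S) (𝔖 S) (𝔄 S)
              (sizesOf 𝔊 𝔠 (XeOf 𝔊 𝔠 X₀ hstd w hX hX0 hC Bk S) (coef S))) ∧
          w'.up P = ofPrintedAllXPNC (Xc.withTowerRuns10 fun S : ScalesLE L ((min (gammaN08d 𝔠) 1) ^ 2) =>
            towerOf 𝔠.lane (XeOf 𝔊 𝔠 X₀ hstd w hX hX0 hC Bk S.1) (𝔖 S.1)) Y Z V W) :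
    ∀ w', Rec w' → ∀ P, Dag.B10_main (leavesP w' P) := by
  intro w' hw' P
  obtain ⟨𝔠, hC, X, hX, hX0, X₀, hstd, w, Bk, 𝔖, 𝔄, coef, Xc, Y, Z, V, W, hD, hup⟩ := hpin w' hw' P
  exact b10_main_upC_XeOf 𝔊 𝔠 X₀ hstd w hX hX0 hC Bk 𝔖 𝔄 coef Xc Y Z V W w' P hD hup

end Summit.QuantumFields.YangMills.Theorems.BalabanUVNodesN08AlphaProfileRecord

end
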